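import Literature.MathematicalPhysics.QuantumFieldTheory.CCHS2024.Langevin2D
import HarnessLib

/-!
# Chandra–Chevyrev–Hairer–Shen: gauge covariance in law of the renormalised 2D stochastic Yang–Mills
# equation — the gauge-transformed system (2.5), the reduced gauge group `𝔊̊^{0,α}`, and
# "the desired form of gauge covariance for the choice `C = C̄`" (Publ. Math. IHÉS 136 (2022), §2.2, §7.1)

Cross-ladder literature typing (R141 (D) item (5), seventh file; venue `CCHS2024/`). STATEMENTS ONLY —
hypothesis-free definitions and one printed consequence of Theorem 2.9 as a named `Prop`; nothing here
is a claim about the Yang–Mills mass gap. Companion of `Langevin2D.lean` (equation (2.2), `C̄ = λ·c_χ`,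
the mollified white noise, `(Ω¹_α)^sol`). Source: A. Chandra, I. Chevyrev, M. Hairer, H. Shen,
*Langevin dynamic for the 2D Yang–Mills measure*, Publ. Math. IHÉS 136 (2022) 1–147, arXiv:2006.04987
(held `paper:arxiv-2006.04987`; bib `ChandraChevyrevHairerShen2022YM2`); numbering as in the sibling
files (§2: Thm 2.9, Rem 2.10; §7: Rem 7.1 (`rem:Uh_vs_g`), …, Prop 7.37 (`prop:SPDEs_conv_zero`)).

## The printed statements

* **(2.5), §2.2.** For a time-dependent gauge transformation `g`, `B ≔ A^g` and `g` satisfy, in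
  coordinates, `∂_t B_i = ΔB_i + g ξ^ε_i g⁻¹ + C B_i + C (∂_i g)g⁻¹ + [B_j, 2∂_j B_i − ∂_i B_j + [B_j,B_i]]`,
  `B(0) = a^{g(0)} ∈ Ω¹_α`, and `(∂_t g)g⁻¹ = ∂_j((∂_j g)g⁻¹) + [B_j, (∂_j g)g⁻¹]`, `g(0) ∈ 𝔊^{0,α}`.
  "As discussed above, `B = A^g` (i.e. `B` is pathwise gauge equivalent to `A`) for any choice of `C`."
* **The reduced gauge group.** For `α > ½`, `𝔊̊^{0,α}` is the quotient of `𝔊^{0,α}` by the kernel of its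
  action on `ΩC^{α−1}` (the constant `g` with values in the kernel of `Ad`), `g ↦ [g]`; §7.1:
  `𝔊̊^{0,α} ↪ Ĝ^{0,α} ≔ C^{0,α}(𝕋², L(𝔤,𝔤)) × Ω¹_α`, `[g] ↦ (U,h)`, `h ≔ (dg)g⁻¹ = −0^g`, `U ≔ Ad_g`, "a
  homeomorphism onto its image" (Rem. 7.1); `S ≔ Ω¹_α × 𝔊̊^{0,α}` (proof of Prop. 7.37).
* **Theorem 2.9 (i)** (quoted in `Langevin2D.lean`): for non-anticipative `χ` there is a unique
  `ε`-independent `C̄ ∈ L_G(𝔤,𝔤)` such that for all `C`, `a`, `g(0)`, the solutions `(B,g)` of (2.5) and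
  `(Ā,ḡ)` of (2.7) (driven by `χ^ε ∗ (ḡ ξ ḡ⁻¹)`, extra drift `(C − C̄)(∂_i ḡ)ḡ⁻¹`) satisfy: `(Ā,[ḡ])` and
  `(B,[g])` converge in probability to the same limit in `(Ω¹_α × 𝔊̊^{0,α})^sol` as `ε → 0`.
* **The paragraph following Theorem 2.9** (the statement typed here): "if `χ` is non-anticipative, then
  `χ^ε ∗ (ḡ ξ_i ḡ⁻¹)` is equal in law to `ξ^ε_i` by Itô isometry since `ḡ` is adapted, so that when
  `C = C̄`, the law of `Ā` does not depend on `ḡ` anymore and `Ā` is equal in law to the process `Ã`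
  defined in (e:tildeA) [the display preceding (2.5)], obtained by starting the dynamics for `A` from `a^{g(0)}`. The theorem therefore
  proves the desired form of gauge covariance for the choice `C = C̄`." In the proof of Prop. 7.37
  (§7.3): "`(A,[ǧ])` converges in `S^sol`", `A` solving (2.2) from `a^{g(0)}` and `ǧ` the corresponding
  gauge equation driven by `A`.

## What is typed (print → Lean)

* The reduced-group distance through the embedding `(U,h)`: `adDiff`, `adSupDist`, `adHolderDist`
  (`|Ad_g − Ad_{g'}|_{C^α}` with the operator size on `𝔤`), `reducedGaugeDist` (adds `|0^g − 0^{g'}|_α`),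
  the product distance `pairDist` on `S = Ω¹_α × 𝔊̊^{0,α}` (on representatives) and `S^sol`
  (`pairHatH`, `pairHatDist`, `pairConeDist`, `pairRunSup`, `pairThetaL`, `pairDistL`, `pairSolDist`,
  `IsPairSolPath`) — the construction of §1.5.1 with `F = S`, `o = (0,[1])`.
* The gauge-transformed system (2.5) and the pair "(2.2) from `a^{g(0)}` + gauge equation" as classical
  PDE systems for a smooth noise sample (`dgGinv`, `dtgGinv`, `SolvesGaugeEq`, `IsClassicalGaugedSYM`,
  `IsClassicalSYMWithGauge`, `pairLift`).
* Fact **`gaugeCovarianceInLaw2D`**: for `C = C̄(χ)` the `ε → 0` limits in probability, in `S^sol`, of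
  `(B^ε,[g^ε])` and of `(Ã^ε,[g̃^ε])` exist and have the same law.

## Renderings (recorded for the reviewer)

* (R1)–(R4), (R7)–(R10) of the sibling files stay in force; simple `𝔤` and `C̄ = λ·c_χ` (Rem. 2.10) as
  in `Langevin2D.lean`. -- TODO(general form): reductive `𝔤`.
* (R25) **`S` and `S^sol`.** `𝔊̊^{0,α}` is identified (Rem. 7.1) with its image `(Ad_g, −0^g)` in
  `C^{0,α}(𝕋², L(𝔤,𝔤)) × Ω¹_α`; the typed distance between `[g]` and `[g']` is
  `|Ad_g − Ad_{g'}|_∞ + |Ad_g − Ad_{g'}|_{α-Höl} + |0^g − 0^{g'}|_α`, operators on `𝔤` sized by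
  `sup{|T X| : X ∈ 𝔤, |X| ≤ 1}` (Frobenius sizes, R2), and `S` carries the sum distance
  `|A − A'|_α + d([g],[g'])` (print: the product of Banach spaces; any equivalent product norm gives the
  same topology on `S` and on `S^sol` by the Lemma of §1.5.1, hence the same convergence in probability
  and the same laws). `0^g` is `gaugeAct r g 0` (Def. 3.26). `S^sol` is built from this distance with
  base point `(0, [1])` exactly as `(Ω¹_α)^sol` in `Langevin2D.lean` (cut-off `ψ` quantified, R10).
* (R26) **Maximal solutions.** `(B,g)` is the maximal smooth solution of (2.5) in
  `(Ω¹_α × 𝔊^{0,α})^sol`: blow-up means `|B(t)|_α + |g(t)|_{α-Höl} → ∞` (Prop. 7.37: "smooth maximal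
  solution in `(Ω¹_α × 𝔊^{0,α})^sol`"); the same for the triangular pair `(Ã, g̃)` ("(SPDE for `g`) is
  classically well-posed for any `A ∈ (Ω¹_α)^sol` … it might blow up before `A` does"). The
  `S^sol`-valued random variables compared are the projections `(B,[g])`, `(Ã,[g̃])`, read through
  `pairDist` (which only sees `[g]`). Classical well-posedness of these smooth-noise systems is
  presupposed as in `localExistence2D`. Print obtains Thm 2.9 from Prop. 7.37, whose systems carry the
  constants `C + o(1)` as `ε ↓ 0` ("`C = C̄^ε_1 + o(1)` … The desired statement then follows from
  Proposition 7.37"); as in print's own statement of Thm 2.9 and of the `Ã`-equation, the typed systems carry the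
  fixed constant `C = C̄`.
* (R27) **Laws.** Equality in law of the two `S^sol`-valued limits is typed as equality of the
  probabilities of all finite intersections of open `D`-balls about fixed paths (a π-system generating
  the Borel σ-algebra of the separable metric space `S^sol`, §1.5.1), for every admissible cut-off `ψ`.

## Not transcribed

Theorem 2.9 (i) itself — the system (2.7) driven by the conjugated un-mollified noise
`χ^ε ∗ (1_{t<0}ξ + 1_{t≥0} ḡ ξ^δ ḡ⁻¹)`, `δ ↓ 0`, and the statement that `(Ā,[ḡ])`, `(B,[g])` have the same
limit in probability — and the uniqueness of `C̄` among `ε`-independent elements of `L_G(𝔤,𝔤)`; both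
stay quoted (here and in `gaugeCovariantConstant_mollifierIndependent`). Also not transcribed: the
linearised variables `(U,h)` as solutions of the parabolic system of Lemma 7.2 (first lemma of §7.1), regularity structures (§7.2).
-/

noncomputable section

open MeasureTheory Filter Topology ProbabilityTheory
open scoped ENNReal NNReal

namespace Literature.MathematicalPhysics.QuantumFieldTheory.CCHS2024

open Literature.MathematicalPhysics.QuantumLattice (IsSimpleCompactGroup)

/-! ### The reduced gauge group `𝔊̊^{0,α}` through `(U,h) = (Ad_g, −0^g)` and the space `S` -/

section Reduced

variable {G : Type*} [Group G] [TopologicalSpace G] (r : LatticeRep G)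

/-- `(Ad_g − Ad_{g'}) X = g X g⁻¹ − g' X g'⁻¹` for `g, g' ∈ G` (`ρ(G)` unitary: `g⁻¹ = g^*`).
[cite: ChandraChevyrevHairerShen2022YM2, §7.1 (second display: h ≔ (dg)g⁻¹ = −0^g, U ≔ Ad_g) and Rem. 7.1] -/
def adDiff (g g' : G) (X : Matrix (Fin r.N) (Fin r.N) ℂ) : Matrix (Fin r.N) (Fin r.N) ℂ :=
  r.ρ g * X * star (r.ρ g) - r.ρ g' * X * star (r.ρ g')

/-- `|Ad_g − Ad_{g'}|_∞ = sup_x |Ad_{g(x)} − Ad_{g'(x)}|_{L(𝔤,𝔤)}`, operators on `𝔤` sized by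
`sup{|T X| : X ∈ 𝔤, |X| ≤ 1}` (R25). [cite: ChandraChevyrevHairerShen2022YM2, §7.1 (first display: 𝔊̊^{0,α} ↪ Ĝ^{0,α} = C^{0,α}(𝕋², L(𝔤,𝔤)) × Ω¹_α) and Rem. 7.1] -/
def adSupDist (g g' : E2 → G) : ℝ≥0∞ :=
  ⨆ (x : E2) (X : Matrix (Fin r.N) (Fin r.N) ℂ) (_ : X ∈ r.lieAlg) (_ : frobNorm X ≤ 1),
    ENNReal.ofReal (frobNorm (adDiff r (g x) (g' x) X))

/-- `|Ad_g − Ad_{g'}|_{α-Höl}` (torus distance, operator size on `𝔤`) (R25).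
[cite: ChandraChevyrevHairerShen2022YM2, §7.1 (first display: the inclusion into C^{0,α}(𝕋², L(𝔤,𝔤)) × Ω¹_α) and §1.5 (|f|_{C^α} ≔ |f|_∞ + |f|_{α-Höl})] -/
def adHolderDist (α : ℝ) (g g' : E2 → G) : ℝ≥0∞ :=
  ⨆ (x : E2) (y : E2) (_ : 0 < torusDist x y) (X : Matrix (Fin r.N) (Fin r.N) ℂ) (_ : X ∈ r.lieAlg)
    (_ : frobNorm X ≤ 1),
    ENNReal.ofReal (frobNorm (adDiff r (g x) (g' x) X - adDiff r (g y) (g' y) X) / torusDist x y ^ α)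

/-- **The distance between `[g]` and `[g']` in `𝔊̊^{0,α} ⊂ C^{0,α}(𝕋², L(𝔤,𝔤)) × Ω¹_α`**:
`|Ad_g − Ad_{g'}|_{C^α} + |0^g − 0^{g'}|_α`, `h = (dg)g⁻¹ = −0^g` (R25).
[cite: ChandraChevyrevHairerShen2022YM2, §7.1 (first two displays: 𝔊̊^{0,α} ↪ Ĝ^{0,α}, [g] ↦ (U,h), h ≔ (dg)g⁻¹ = −0^g, U ≔ Ad_g) and Rem. 7.1; §2.2 (the reduced gauge group)] -/
def reducedGaugeDist (α : ℝ) (g g' : E2 → G) : ℝ≥0∞ :=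
  adSupDist r g g' + adHolderDist r α g g' + alphaNorm α (gaugeAct r g 0 - gaugeAct r g' 0)

/-- The distance on `S = Ω¹_α × 𝔊̊^{0,α}` (on representatives): `|A − A'|_α + d([g],[g'])` (R25).
[cite: ChandraChevyrevHairerShen2022YM2, §7.3 proof of Prop. 7.37 (S ≔ Ω¹_α × 𝔊̊^{0,α}) with §7.1 (first display)] -/
def pairDist (α : ℝ) (u v : LineFn r.N × (E2 → G)) : ℝ≥0∞ :=
  alphaNorm α (u.1 - v.1) + reducedGaugeDist r α u.2 v.2

/-- The base point `o = (0, [1])` of `S`. [cite: ChandraChevyrevHairerShen2022YM2, §1.5.1 ("o ∈ F is any fixed element")] -/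
def pairBase : LineFn r.N × (E2 → G) := (0, fun _ => 1)

/-! `S^sol`: the construction of §1.5.1 with `F = S` (R25, R10). -/

/-- `h[f] = (1 + d(f,o))⁻¹`, `h[☠] = 0`, for `F = S`. [cite: ChandraChevyrevHairerShen2022YM2, §1.5.1 (h : F̂ → [0,1])] -/
def pairHatH (α : ℝ) (x : Option (LineFn r.N × (E2 → G))) : ℝ :=
  x.elim 0 fun u => (1 + (pairDist r α u (pairBase r)).toReal)⁻¹

/-- `d̂(f,g) = d(f,g) ∧ (h[f] + h[g])` on `Ŝ`. [cite: ChandraChevyrevHairerShen2022YM2, §1.5.1 eq. (1.11)] -/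
def pairHatDist (α : ℝ) (x y : Option (LineFn r.N × (E2 → G))) : ℝ :=
  x.elim (pairHatH r α x + pairHatH r α y) fun u =>
    y.elim (pairHatH r α x + pairHatH r α y) fun v =>
      min (pairDist r α u v).toReal (pairHatH r α x + pairHatH r α y)

/-- The cone metric `|a − b| + (a ∧ b) d̂(f,g)` on `CŜ`. [cite: ChandraChevyrevHairerShen2022YM2, §1.5.1 (the cone CF̂)] -/
def pairConeDist (α : ℝ) (p q : ℝ × Option (LineFn r.N × (E2 → G))) : ℝ :=
  abs (p.1 - q.1) + min p.1 q.1 * pairHatDist r α p.2 q.2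

/-- `S_f(t) = sup_{s ≤ t} d(f(s), o)`. [cite: ChandraChevyrevHairerShen2022YM2, §1.5.1 eq. (1.12)] -/
def pairRunSup (α : ℝ) (f : ℝ → Option (LineFn r.N × (E2 → G))) (t : ℝ) : ℝ≥0∞ :=
  ⨆ (s : ℝ) (_ : s ∈ Set.Icc 0 t), (f s).elim ∞ fun u => pairDist r α u (pairBase r)

/-- `Θ_L(f)(t) = (ψ(S_f(t)/L), f(t))`. [cite: ChandraChevyrevHairerShen2022YM2, §1.5.1 eq. (1.13)] -/
def pairThetaL (ψ : ℝ → ℝ) (α : ℝ) (L : ℕ) (f : ℝ → Option (LineFn r.N × (E2 → G))) (t : ℝ) :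
    ℝ × Option (LineFn r.N × (E2 → G)) :=
  (if pairRunSup r α f t = ∞ then 0 else ψ ((pairRunSup r α f t).toReal / L), f t)

/-- `D_L(f,g) = sup_{t∈[0,L]} d̂(Θ_L(f)(t), Θ_L(g)(t))`. [cite: ChandraChevyrevHairerShen2022YM2, §1.5.1 eq. (1.14)] -/
def pairDistL (ψ : ℝ → ℝ) (α : ℝ) (L : ℕ) (f g : ℝ → Option (LineFn r.N × (E2 → G))) : ℝ :=
  ⨆ t : Set.Icc (0 : ℝ) L, pairConeDist r α (pairThetaL r ψ α L f t) (pairThetaL r ψ α L g t)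

/-- **The metric `D = ∑_{L≥1} 2^{−L} D_L` of `S^sol`**, `S = Ω¹_α × 𝔊̊^{0,α}` (R25).
[cite: ChandraChevyrevHairerShen2022YM2, §1.5.1 (D ≔ ∑ 2^{−L} D_L) and Thm 2.9 (i) ((Ω¹_α × 𝔊̊^{0,α})^sol)] -/
def pairSolDist (ψ : ℝ → ℝ) (α : ℝ) (f g : ℝ → Option (LineFn r.N × (E2 → G))) : ℝ :=
  ∑' L : ℕ, ((1 : ℝ) / 2) ^ (L + 1) * pairDistL r ψ α (L + 1) f g

/-- **`f ∈ S^sol`** (on representatives): before its blow-up time `T ∈ (0,∞]`, `f(t) = (A(t), g(t))` with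
`A(t) ∈ Ω¹_α`, `g(t) ∈ 𝔊^{0,α}`, continuous for the distance of `S`; `☠` from `T` on; `d(f(t), o) → ∞` as
`t ↑ T < ∞`. [cite: ChandraChevyrevHairerShen2022YM2, §1.5.1 (F^sol) and Thm 2.9 (i) ((Ω¹_α × 𝔊̊^{0,α})^sol)] -/
def IsPairSolPath (α : ℝ) (f : ℝ → Option (LineFn r.N × (E2 → G))) : Prop :=
  ∃ T : ℝ≥0∞, 0 < T ∧
    (∀ t : ℝ, 0 ≤ t → (f t = none ↔ T ≤ ENNReal.ofReal t)) ∧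
    (∀ t : ℝ, 0 ≤ t → ∀ u, f t = some u → u.1 ∈ Omega1 r.lieAlg α ∧ u.2 ∈ LittleGaugeGroup r α) ∧
    (∀ t : ℝ, 0 ≤ t → ∀ u, f t = some u → ∀ ε : ℝ, 0 < ε → ∃ δ : ℝ, 0 < δ ∧
        ∀ s : ℝ, 0 ≤ s → |s - t| < δ → ∀ v, f s = some v → pairDist r α u v < ENNReal.ofReal ε) ∧
    (T < ∞ → ∀ R : ℝ, ∃ δ : ℝ, 0 < δ ∧ ∀ s : ℝ, 0 ≤ s → ENNReal.ofReal s < T →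
        T.toReal - δ < s → ∀ v, f s = some v → ENNReal.ofReal R < pairDist r α v (pairBase r))

end Reduced

/-! ### The gauge-transformed system (2.5) and the pair "(2.2) from `a^{g(0)}` + gauge equation" -/

section Systems

variable {G : Type*} [Group G] [TopologicalSpace G] (r : LatticeRep G)

/-- `(∂_i g) g⁻¹` at `(t,x)` for a time-dependent gauge transformation (through `ρ`, entrywise
derivatives; `g⁻¹ = g^*`). [cite: ChandraChevyrevHairerShen2022YM2, §2.2 eq. (2.5) (the terms (∂_i g)g⁻¹)] -/
def dgGinv (g : ℝ → E2 → G) (t : ℝ) (x : E2) (i : Fin 2) : Matrix (Fin r.N) (Fin r.N) ℂ :=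
  pdX i (fun y => r.ρ (g t y)) x * star (r.ρ (g t x))

/-- `(∂_t g) g⁻¹` at `(t,x)`. [cite: ChandraChevyrevHairerShen2022YM2, §2.2 eq. (2.5) (the term (∂_t g)g⁻¹)] -/
def dtgGinv (g : ℝ → E2 → G) (t : ℝ) (x : E2) : Matrix (Fin r.N) (Fin r.N) ℂ :=
  Matrix.of (fun a b => deriv (fun s : ℝ => r.ρ (g s x) a b) t) * star (r.ρ (g t x))

/-- The gauge equation driven by `B` at `(t,x)`:
`(∂_t g)g⁻¹ = ∑_j (∂_j((∂_j g)g⁻¹) + [B_j, (∂_j g)g⁻¹])`.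
[cite: ChandraChevyrevHairerShen2022YM2, §2.2 eq. (2.5) (second equation) and eq. (2.7) (second equation)] -/
def SolvesGaugeEq (B : TimeForm r.N) (g : ℝ → E2 → G) (t : ℝ) (x : E2) : Prop :=
  dtgGinv r g t x =
    ∑ j : Fin 2, (pdX j (fun y => dgGinv r g t y j) x + comm (B t x j) (dgGinv r g t x j))

/-- **Classical maximal solution `(B, g)` of the gauge-transformed system (2.5) on `[0,T)`** for a smooth
noise sample `ζ` (= `ξ^ε`), constant `C`, data `a ∈ Ω¹_α`, `g₀ ∈ 𝔊^{0,α}`: `B`, `g` smooth and periodic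
on `(0,T) × 𝕋²`, `B` `𝔤`-valued;
`∂_t B_i = ΔB_i + g ζ_i g⁻¹ + C B_i + C (∂_i g)g⁻¹ + ∑_j[B_j, 2∂_j B_i − ∂_i B_j + [B_j,B_i]]`; the gauge
equation driven by `B`; `B(t) → a^{g₀}` in `Ω¹_α` and `g(t) → g₀` in `𝔊^α` as `t ↓ 0`; maximality in
`(Ω¹_α × 𝔊^{0,α})^sol`: `|B(t)|_α + |g(t)|_{α-Höl} → ∞` as `t ↑ T < ∞` (R26).
[cite: ChandraChevyrevHairerShen2022YM2, §2.2 eq. (2.5) with Thm 2.9 (i) ("let (B,g) be the solution to (2.5)") and Prop. 7.37] -/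
def IsClassicalGaugedSYM (C : Matrix (Fin r.N) (Fin r.N) ℂ →ₗ[ℝ] Matrix (Fin r.N) (Fin r.N) ℂ)
    (ζ : SpaceTime2 → Fin 2 → Matrix (Fin r.N) (Fin r.N) ℂ) (a : LineFn r.N) (g₀ : E2 → G) (α : ℝ)
    (T : ℝ≥0∞) (B : TimeForm r.N) (g : ℝ → E2 → G) : Prop :=
  0 < T ∧
  (∀ (i : Fin 2) (c d : Fin r.N), ContDiffOn ℝ (⊤ : ℕ∞) (fun p : SpaceTime2 => B p.1 p.2 i c d)
    {p | 0 < p.1 ∧ ENNReal.ofReal p.1 < T}) ∧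
  (∀ c d : Fin r.N, ContDiffOn ℝ (⊤ : ℕ∞) (fun p : SpaceTime2 => r.ρ (g p.1 p.2) c d)
    {p | 0 < p.1 ∧ ENNReal.ofReal p.1 < T}) ∧
  (∀ t : ℝ, 0 < t → ENNReal.ofReal t < T →
    (B.slice t).IsPeriodic ∧ (B.slice t).ValuedIn r.lieAlg ∧ IsPeriodicGauge (g t) ∧
    ∀ x : E2, SolvesGaugeEq r B g t x ∧ ∀ i : Fin 2,
      pdT B t x i = laplacian2 (B.slice t i) x + r.ρ (g t x) * ζ (t, x) i * star (r.ρ (g t x)) +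
        C (B t x i) + C (dgGinv r g t x i) + symDrift (B.slice t) i x) ∧
  Tendsto (fun t : ℝ => alphaNorm α (lineIntegral (B.slice t) - gaugeAct r g₀ a)) (𝓝[>] 0) (𝓝 0) ∧
  Tendsto (fun t : ℝ => gaugeDist r α (g t) g₀) (𝓝[>] 0) (𝓝 0) ∧
  (T < ∞ → Tendsto (fun t : ℝ => alphaNorm α (lineIntegral (B.slice t)) + gaugeHolder r α (g t))
    (𝓝[<] T.toReal) (𝓝 ∞))

/-- **Classical maximal solution `(Ã, g̃)` of "(2.2) started from `a^{g₀}`" coupled with the gauge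
equation driven by `Ã` from `g₀`** (the process `Ã` of the display preceding (2.5), TeX label `e:tildeA`, and `ǧ`/`ḡ` of (2.7), second equation), for a
smooth noise sample `ζ`: `∂_t Ã_i = ΔÃ_i + ζ_i + C Ã_i + ∑_j[…]`, `Ã(0) = a^{g₀}`;
`(∂_t g̃)g̃⁻¹ = ∂_j((∂_j g̃)g̃⁻¹) + [Ã_j, (∂_j g̃)g̃⁻¹]`, `g̃(0) = g₀`; maximality as in (R26).
[cite: ChandraChevyrevHairerShen2022YM2, §2.2 (the display `e:tildeA` preceding (2.5): the process Ã started from a^{g(0)}) and eq. (2.7) (second equation); §7.3 proof of Prop. 7.37 ("(A,[ǧ]) converges in S^sol")] -/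
def IsClassicalSYMWithGauge (C : Matrix (Fin r.N) (Fin r.N) ℂ →ₗ[ℝ] Matrix (Fin r.N) (Fin r.N) ℂ)
    (ζ : SpaceTime2 → Fin 2 → Matrix (Fin r.N) (Fin r.N) ℂ) (a : LineFn r.N) (g₀ : E2 → G) (α : ℝ)
    (T : ℝ≥0∞) (A : TimeForm r.N) (g : ℝ → E2 → G) : Prop :=
  0 < T ∧
  (∀ (i : Fin 2) (c d : Fin r.N), ContDiffOn ℝ (⊤ : ℕ∞) (fun p : SpaceTime2 => A p.1 p.2 i c d)
    {p | 0 < p.1 ∧ ENNReal.ofReal p.1 < T}) ∧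
  (∀ c d : Fin r.N, ContDiffOn ℝ (⊤ : ℕ∞) (fun p : SpaceTime2 => r.ρ (g p.1 p.2) c d)
    {p | 0 < p.1 ∧ ENNReal.ofReal p.1 < T}) ∧
  (∀ t : ℝ, 0 < t → ENNReal.ofReal t < T →
    (A.slice t).IsPeriodic ∧ (A.slice t).ValuedIn r.lieAlg ∧ IsPeriodicGauge (g t) ∧
    ∀ x : E2, SolvesGaugeEq r A g t x ∧ ∀ i : Fin 2,
      pdT A t x i = laplacian2 (A.slice t i) x + ζ (t, x) i + C (A t x i) + symDrift (A.slice t) i x) ∧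
  Tendsto (fun t : ℝ => alphaNorm α (lineIntegral (A.slice t) - gaugeAct r g₀ a)) (𝓝[>] 0) (𝓝 0) ∧
  Tendsto (fun t : ℝ => gaugeDist r α (g t) g₀) (𝓝[>] 0) (𝓝 0) ∧
  (T < ∞ → Tendsto (fun t : ℝ => alphaNorm α (lineIntegral (A.slice t)) + gaugeHolder r α (g t))
    (𝓝[<] T.toReal) (𝓝 ∞))

/-- The `S^sol`-path `t ↦ (ι B(t), g(t))` of a classical solution pair on `[0,T)` with initial data
`(a', g₀)`: the data at (and before) `t = 0`, `☠` from `T` on. [cite: ChandraChevyrevHairerShen2022YM2, Thm 2.9 (i) ((B,[g]) as an element of (Ω¹_α × 𝔊̊^{0,α})^sol) and §1.5.1] -/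
def pairLift (a' : LineFn r.N) (g₀ : E2 → G) (T : ℝ≥0∞) (B : TimeForm r.N) (g : ℝ → E2 → G) :
    ℝ → Option (LineFn r.N × (E2 → G)) := fun t =>
  if t ≤ 0 then some (a', g₀)
  else if ENNReal.ofReal t < T then some (lineIntegral (B.slice t), g t) else none

end Systems

/-! ### Gauge covariance in law for `C = C̄` -/

section Theorems

/-- **Gauge covariance in law of the 2D SYM dynamic for `C = C̄` (the paragraph following Theorem 2.9,
with Thm 2.9 (i)–(ii), Rem. 2.10 and the proof of Prop. 7.37), simple `𝔤`.** Let `G` be compact simple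
with adjoint Casimir scalar `λ`, `α ∈ (2/3,1)`, `χ` a non-anticipative mollifier and `C̄ = λ·c_χ`
(`cbar`). For `a ∈ Ω¹_α`, `g₀ ∈ 𝔊^{0,α}` and the mollifications `ξ^{χ,ε}` of a white noise: let
`(B^ε, g^ε)` be the maximal classical solutions of the gauge-transformed system (2.5) with `C = C̄`
(noise `g ξ^ε g⁻¹`, data `(a^{g₀}, g₀)`; pathwise `B^ε = (A^ε)^{g^ε}`, `A^ε` solving (2.2) from `a`),
and let `(Ã^ε, g̃^ε)` be the maximal classical solutions of (2.2) with `C = C̄` started from `a^{g₀}`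
together with the gauge equation driven by `Ã^ε` from `g₀`. Then `(B^ε,[g^ε])` and `(Ã^ε,[g̃^ε])`
converge in probability in `(S^sol, D)`, `S = Ω¹_α × 𝔊̊^{0,α}`, as `ε → 0`, and the two limits have the
SAME LAW — "the desired form of gauge covariance for the choice `C = C̄`": the gauge transform of the
dynamic from `a` is, in law and modulo the reduced gauge group, the dynamic from `a^{g₀}` (R25–R27).
Print's Thm 2.9 (i) (same limit in probability for the conjugated-noise system (2.7)) and the uniqueness
of `C̄` are quoted, not typed.
[cite: ChandraChevyrevHairerShen2022YM2, §2.2: Thm 2.9 (i)–(ii) and the paragraph following it ("Ā is equal in law to the process Ã … The theorem therefore proves the desired form of gauge covariance for the choice C = C̄"), eqs. (2.5), (2.7) and the display preceding (2.5) (Ã), Rem. 2.10; §7.3 proof of Prop. 7.37] -/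
def gaugeCovarianceInLaw2D : Prop :=
  ∀ (G : Type) [Group G] [TopologicalSpace G] [CompactSpace G], IsSimpleCompactGroup G →
    ∀ (r : LatticeRep G) (lam : ℝ), IsAdCasimirScalar r lam → ∀ (α : ℝ), 2 / 3 < α → α < 1 →
    ∀ (χ : SpaceTime2 → ℝ), IsSpaceTimeMollifier χ → IsNonAnticipative χ →
    ∀ (Ω : Type) [MeasurableSpace Ω] (P : Measure Ω) [IsProbabilityMeasure P]
      (ζ : NoiseFamily r.N Ω), IsMollifiedWhiteNoise r P ζ →
    ∀ a ∈ Omega1 r.lieAlg α, ∀ g₀ ∈ LittleGaugeGroup r α, ∀ (ψ : ℝ → ℝ), IsAdmissibleCutoff ψ →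
    ∀ (Y Yt : ℝ → Ω → ℝ → Option (LineFn r.N × (E2 → G))),
      (∀ ε : ℝ, 0 < ε → ε ≤ 1 → ∀ᵐ ω ∂P,
        (∃ (T : ℝ≥0∞) (B : TimeForm r.N) (g : ℝ → E2 → G),
          IsClassicalGaugedSYM r (cbar lam χ • LinearMap.id) (matrixNoise r ζ χ ε ω) a g₀ α T B g ∧
            Y ε ω = pairLift r (gaugeAct r g₀ a) g₀ T B g) ∧
        (∃ (T : ℝ≥0∞) (A : TimeForm r.N) (g : ℝ → E2 → G),
          IsClassicalSYMWithGauge r (cbar lam χ • LinearMap.id) (matrixNoise r ζ χ ε ω) a g₀ α T A g ∧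
            Yt ε ω = pairLift r (gaugeAct r g₀ a) g₀ T A g)) →
      ∃ L Lt : Ω → ℝ → Option (LineFn r.N × (E2 → G)),
        (∀ᵐ ω ∂P, IsPairSolPath r α (L ω) ∧ IsPairSolPath r α (Lt ω)) ∧
        (∀ δ : ℝ, 0 < δ →
          Tendsto (fun ε : ℝ => P {ω | δ < pairSolDist r ψ α (Y ε ω) (L ω)}) (𝓝[>] 0) (𝓝 0) ∧
          Tendsto (fun ε : ℝ => P {ω | δ < pairSolDist r ψ α (Yt ε ω) (Lt ω)}) (𝓝[>] 0) (𝓝 0)) ∧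
        ∀ (n : ℕ) (f : Fin n → ℝ → Option (LineFn r.N × (E2 → G))) (ρ : Fin n → ℝ),
          P {ω | ∀ k, pairSolDist r ψ α (L ω) (f k) < ρ k} =
            P {ω | ∀ k, pairSolDist r ψ α (Lt ω) (f k) < ρ k}

end Theorems

end Literature.MathematicalPhysics.QuantumFieldTheory.CCHS2024
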